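import Literature.Geometry.ComplexHyperbolic.UnitBallTwoLevelIntegral             -- ★ p843942 (β-1b): two-level ∕ chart integration formula on `U(2,1)`
import Literature.Geometry.ComplexHyperbolic.UnitBallRegularOrbitSupportBound      -- ★ (this seat): the one-level support bound in the D regime
import Literature.Geometry.ComplexHyperbolic.UnitBallDiscontinuousCornerFinite     -- ★ `isCompact_setOf_nsq_le` (closed sub-balls are compact), `nsq_smul_x₀_le_of_norm_22_le`
import Literature.Geometry.ComplexHyperbolic.UnitBallSheetIntegralBounds           -- ★ `isCompact_setOf_nsq_le_ambient`, `measurableSet_setOf_nsq_le`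
import HarnessLib

/-!
# The D-regime bound for the regular orbital integral of `U(2,1)` near the centre: `‖Φ_Θ(t)‖ ≤ 2·B·C_μ·R²∕m²` and `|Δ(t)|·‖Φ_Θ(t)‖ ≤ 4·B·C_μ·R²·M²∕m` — so `ρ′Δ·Φ_Θ → 0` at the
# corner along every D-sub-cone (ROAD A; the order-0 shadow of (A6) on the D region, in-house; Rogawski 1990 §8.4; Harish-Chandra 1975 §17 for the statement it supports)

Topic `Geometry/ComplexHyperbolic`; namespace `Literature.Geometry.ComplexHyperbolic.BallModel`.  THEOREMS ONLY (no `def`, no instance, no notation, no axiom, no named fact, no `sorry`).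
Cell `pub/hodgecm-mathlib`, ENGINE T1 (crux H413 = `stmt-HodgeConjecture-24833`); ROAD A (N1 = `stub_L21` ∕ `stub_ArchCentralLimitU21`); the owner's census `CENSUS-beta-TwoScaleRegularOrbital`
9b1ba5d9 §3 and F0P3a-p02 (g13)'s census (ζ3) §2 («D chambers: `Φ ≍ θ⁻²`, `F = ρ′Δ·Φ = O(θ) → 0`») — PROVED here as explicit inequalities in `U21` tokens; author F0P3a-p05 (g14) (ROAD A owner),
2026-09-01.

THE MATHEMATICS.  `G = U(2,1)`, `μ` Haar, `t = diag(z₀,z₁,z₂)`, `Φ_Θ(t) = ∫_G Θ(mat(g·t·g⁻¹)) dμ`, `S_ρ := {g : |g₂₂|² ≤ 1 + ρ}`.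
* §1 `|mat(sec z·k)₂₂|² = (1 − |z|²)⁻¹`, `= 1 + |W|²` at `z = chart W` (★ `one_sub_nsq_smul_x₀`, ★ `sec_mul_stabilizer_smul_x₀`, ★ chart identities).
* §2 THE VOLUME OF THE ONE-LEVEL SUPPORT: `S_ρ` is compact and **`μ(S_ρ) = C_μ·ρ²`** (`ρ ≥ 0`), `C_μ = 9a_β⁻¹·m_K(K)·vol{nsq ≤ 1}` (★ two-level∕chart formula on the indicator — the fibre
  integrand is the constant `1_{nsq W ≤ ρ}` — and `vol{nsq ≤ ρ} = ρ²·vol{nsq ≤ 1}` by the `√ρ`-dilation of `ℂ² ≅ ℝ⁴`).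
* §3 THE ORBITAL BOUND: `‖Θ‖ ≤ B` and `Θ(X) = 0` whenever `R ≤ |X₂₂ − z₂|` (every compactly supported `Θ` has such an `R`: ★ `exists_radius_apply_add_eq_zero`); then in the D regime
  `Re((z₂−z₀)conj(z₂−z₁)) ≥ 0`, `0 < m ≤ min(|z₂−z₀|,|z₂−z₁|)`: the integrand lives on `S_{√2R∕m}` (★ `norm_22_sq_le_of_corner_le`), so **`‖Φ_Θ(t)‖ ≤ B·C_μ·2R²∕m²`**.
* §4 THE CORNER: `|z₀−z₁||z₂−z₁||z₂−z₀| ≤ 2·m·M²` (`M = max`), so **`|z₀−z₁||z₂−z₁||z₂−z₀|·‖Φ_Θ(t)‖ ≤ 4BC_μR²·M²∕m`**, `≤ 4BC_μR²κ²·M` on the D-sub-cone `M ≤ κm`: the letter's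
  `F_Θ = ρ′Δ·Φ_Θ` (`|ρ′Δ| = |z₀−z₁||z₂−z₁||z₂−z₀|` on the torus) TENDS TO `0` at the corner along every D-sub-cone.  (S chambers: `F(0⁺) ≠ 0`; not touched.)
HONEST LABEL: HC_CM is proved only modulo the printed citations until rung 0 closes; an elementary estimate, it discharges nothing booked (the letter needs third jets).

## References
* [Rogawski1990] J. D. Rogawski, *Automorphic Representations of Unitary Groups in Three Variables*, Ann. of Math. Stud. 123 (1990), §8.4 pp. 126–127.
* [HarishChandra1975HARRG1] Harish-Chandra, *Harmonic analysis on real reductive groups I*, J. Funct. Anal. 19 (1975), §17.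
* [Rudin1980] W. Rudin, *Function Theory in the Unit Ball of ℂⁿ* (1980), §1.4, §2.2.
* [Helgason2000] S. Helgason, *Groups and Geometric Analysis* (2000), Ch. I §1 No. 2.
-/

set_option autoImplicit false

noncomputable section

open Matrix Complex ComplexConjugate MeasureTheory Measure MulAction Topology Set Function
open scoped ENNReal NNReal Pointwise

namespace Literature.Geometry.ComplexHyperbolic

namespace BallModel

/-! ## §1 The corner entry in the two-level parametrisation -/

section Entry22

/-- **`|mat(sec z·k)₂₂|² = (1 − |z|²)⁻¹`** for `k ∈ K` (★ `one_sub_nsq_smul_x₀` at `g = sec z·k`, whose base point is `z`). [cite: Rudin1980, Thm 2.2.2] -/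
theorem norm_22_sq_sec_mul_stabilizer (z : Ball) (k : stabilizer U21 x₀) : ‖mat (sec z * (k : U21)) 2 2‖ ^ 2 = 1 / (1 - nsq z.1) := by
  have h := one_sub_nsq_smul_x₀ (sec z * (k : U21))
  rw [sec_mul_stabilizer_smul_x₀] at h
  rw [h, one_div_one_div]

/-- … `= 1 + |W|²` at the chart point `z = chart W` (★ `one_sub_nsq_inv_sqrt_one_add_nsq_smul`). [cite: Rudin1980, §2.2] -/
theorem norm_22_sq_sec_chart_mul_stabilizer (W : Fin 2 → ℂ) (k : stabilizer U21 x₀) :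
    ‖mat (sec (proj ![W 0, W 1, (Real.sqrt (1 + nsq W) : ℂ)] (Q_vecCons_sqrt_one_add_nsq_neg W)) * (k : U21)) 2 2‖ ^ 2 = 1 + nsq W := by
  rw [norm_22_sq_sec_mul_stabilizer, coe_proj_vecCons_sqrt, one_sub_nsq_inv_sqrt_one_add_nsq_smul, one_div, inv_inv]

end Entry22

/-! ## §2 The volume of the one-level support `S_ρ = {|g₂₂|² ≤ 1 + ρ}` -/

section Volume

/-- `S_ρ` is the preimage of a closed sub-ball under the orbit map: `|g₂₂|² ≤ 1+ρ ↔ nsq(g•x₀) ≤ 1 − (1+ρ)⁻¹` (★ `one_sub_nsq_smul_x₀`). [cite: Rudin1980, Thm 2.2.2] -/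
theorem norm_22_sq_le_iff_nsq_smul_x₀_le (g : U21) {ρ : ℝ} (hρ : 0 ≤ ρ) : ‖mat g 2 2‖ ^ 2 ≤ 1 + ρ ↔ nsq (g • x₀).1 ≤ 1 - 1 / (1 + ρ) := by
  have h := one_sub_nsq_smul_x₀ g
  have hpos : 0 < ‖mat g 2 2‖ ^ 2 := pow_pos (norm_22_pos g) 2
  have hρ1 : 0 < 1 + ρ := by linarith
  constructor
  · intro hle
    have : 1 / (1 + ρ) ≤ 1 / ‖mat g 2 2‖ ^ 2 := one_div_le_one_div_of_le hpos hle
    linarith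
  · intro hle
    have h1 : 1 / (1 + ρ) ≤ 1 / ‖mat g 2 2‖ ^ 2 := by linarith
    rwa [one_div_le_one_div hρ1 hpos] at h1

/-- **`S_ρ` IS COMPACT** (`ρ ≥ 0`): properness of the orbit map ★ `isCompact_setOf_smul_x₀_mem` and compactness of closed sub-balls ★ `isCompact_setOf_nsq_le`. [cite: Helgason2000, Ch. I §1 No. 2] -/
theorem isCompact_setOf_norm_22_sq_le {ρ : ℝ} (hρ : 0 ≤ ρ) : IsCompact {g : U21 | ‖mat g 2 2‖ ^ 2 ≤ 1 + ρ} := by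
  have hε : 0 < 1 / (1 + ρ) := by positivity
  have hS : {g : U21 | ‖mat g 2 2‖ ^ 2 ≤ 1 + ρ} = {g : U21 | g • x₀ ∈ {z : Ball | nsq z.1 ≤ 1 - 1 / (1 + ρ)}} := by
    ext g
    exact norm_22_sq_le_iff_nsq_smul_x₀_le g hρ
  rw [hS]
  exact isCompact_setOf_smul_x₀_mem (isCompact_setOf_nsq_le hε)

/-- `S_ρ` is measurable. [cite: Rudin1980, §1.4] -/
theorem measurableSet_setOf_norm_22_sq_le (ρ : ℝ) : MeasurableSet {g : U21 | ‖mat g 2 2‖ ^ 2 ≤ 1 + ρ} :=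
  (isClosed_le ((continuous_mat.matrix_elem 2 2).norm.pow 2) continuous_const).measurableSet

/-- The fibre integrand of the indicator of `S_ρ` is the constant `1_{nsq W ≤ ρ}`: `1_{S_ρ}(sec(chart W)·k) = 1_{nsq ≤ ρ}(W)`. [cite: Rudin1980, §2.2] -/
theorem indicator_setOf_norm_22_sq_le_sec_chart_mul (ρ : ℝ) (W : Fin 2 → ℂ) (k : stabilizer U21 x₀) :
    ({g : U21 | ‖mat g 2 2‖ ^ 2 ≤ 1 + ρ}).indicator (1 : U21 → ℝ) (sec (proj ![W 0, W 1, (Real.sqrt (1 + nsq W) : ℂ)] (Q_vecCons_sqrt_one_add_nsq_neg W)) * (k : U21)) =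
      ({W : Fin 2 → ℂ | nsq W ≤ ρ}).indicator (1 : (Fin 2 → ℂ) → ℝ) W := by
  by_cases hW : nsq W ≤ ρ
  · have hmem : sec (proj ![W 0, W 1, (Real.sqrt (1 + nsq W) : ℂ)] (Q_vecCons_sqrt_one_add_nsq_neg W)) * (k : U21) ∈ {g : U21 | ‖mat g 2 2‖ ^ 2 ≤ 1 + ρ} := by
      rw [mem_setOf_eq, norm_22_sq_sec_chart_mul_stabilizer]; linarith
    rw [indicator_of_mem hmem, indicator_of_mem (by exact hW)]
    rfl
  · have hnmem : sec (proj ![W 0, W 1, (Real.sqrt (1 + nsq W) : ℂ)] (Q_vecCons_sqrt_one_add_nsq_neg W)) * (k : U21) ∉ {g : U21 | ‖mat g 2 2‖ ^ 2 ≤ 1 + ρ} := by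
      rw [mem_setOf_eq, norm_22_sq_sec_chart_mul_stabilizer]; intro h; exact hW (by linarith)
    rw [indicator_of_notMem hnmem, indicator_of_notMem (by exact hW)]

/-- **`vol{nsq ≤ ρ} = ρ²·vol{nsq ≤ 1}`** on `ℂ² ≅ ℝ⁴` (`{nsq ≤ ρ} = √ρ • {nsq ≤ 1}`, Mathlib `addHaar_smul_of_nonneg`, `finrank_ℝ ℂ² = 4`). [cite: Rudin1980, §1.4] -/
theorem volume_real_setOf_nsq_le (ρ : ℝ) (hρ : 0 ≤ ρ) :
    (volume : Measure (Fin 2 → ℂ)).real {W : Fin 2 → ℂ | nsq W ≤ ρ} = ρ ^ 2 * (volume : Measure (Fin 2 → ℂ)).real {W : Fin 2 → ℂ | nsq W ≤ 1} := by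
  rcases hρ.eq_or_lt with h0 | hpos
  · -- `ρ = 0`: `{nsq ≤ 0} = {0}` is null
    rw [← h0]
    have hset : {W : Fin 2 → ℂ | nsq W ≤ 0} = {0} := by
      ext W
      simp only [mem_setOf_eq, mem_singleton_iff]
      constructor
      · intro h
        by_contra hW
        exact absurd h (not_le.2 (nsq_pos_of_ne_zero hW))
      · intro h
        rw [h]
        have : nsq (0 : Fin 2 → ℂ) = 0 := by simp [nsq]
        rw [this]
    rw [hset, measureReal_def, measure_singleton, ENNReal.toReal_zero]
    ring
  · have hset : {W : Fin 2 → ℂ | nsq W ≤ ρ} = Real.sqrt ρ • {W : Fin 2 → ℂ | nsq W ≤ 1} := by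
      have hs : 0 < Real.sqrt ρ := Real.sqrt_pos.2 hpos
      ext W
      rw [mem_smul_set_iff_inv_smul_mem₀ hs.ne', mem_setOf_eq, mem_setOf_eq, nsq_real_smul, inv_pow, Real.sq_sqrt hpos.le]
      rw [inv_mul_le_iff₀ hpos, mul_one]
    rw [hset, measureReal_def, measureReal_def, Measure.addHaar_smul_of_nonneg _ (Real.sqrt_nonneg ρ), finrank_real_fin_two_complex,
      ENNReal.toReal_mul, ENNReal.toReal_ofReal (by positivity)]
    congr 1
    rw [show (4 : ℕ) = 2 * 2 from rfl, pow_mul, Real.sq_sqrt hpos.le]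

/-- **THE VOLUME OF THE ONE-LEVEL SUPPORT**: for a Haar measure `μ` on `U(2,1)` there is `C ≥ 0` with `μ.real {g : |g₂₂|² ≤ 1 + ρ} = C·ρ²` for every `ρ ≥ 0`
(`C = 9a_β⁻¹·m_K(K)·vol{nsq ≤ 1}`; ★ two-level∕chart formula on the indicator). [cite: Helgason2000, Ch. I §1 No. 2] [cite: Rudin1980, §2.2] -/
theorem exists_measure_real_setOf_norm_22_sq_le_eq (μ : Measure U21) [μ.IsHaarMeasure] :
    ∃ C : ℝ, 0 ≤ C ∧ ∀ ρ : ℝ, 0 ≤ ρ → μ.real {g : U21 | ‖mat g 2 2‖ ^ 2 ≤ 1 + ρ} = C * ρ ^ 2 := by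
  obtain ⟨c, hc, hcf⟩ := exists_integral_eq_smul_integral_chart_integral_sec_mul (E := ℝ) μ
  refine ⟨c * ((haar : Measure (stabilizer U21 x₀)).real univ * (volume : Measure (Fin 2 → ℂ)).real {W : Fin 2 → ℂ | nsq W ≤ 1}),
    mul_nonneg hc.le (mul_nonneg measureReal_nonneg measureReal_nonneg), fun ρ hρ => ?_⟩
  have hSm := measurableSet_setOf_norm_22_sq_le ρ
  have hint : Integrable (({g : U21 | ‖mat g 2 2‖ ^ 2 ≤ 1 + ρ}).indicator (1 : U21 → ℝ)) μ :=
    (integrable_indicator_iff hSm).2 (integrableOn_const ((isCompact_setOf_norm_22_sq_le hρ).measure_lt_top.ne))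
  rw [← integral_indicator_one hSm, hcf _ hint]
  simp_rw [indicator_setOf_norm_22_sq_le_sec_chart_mul, integral_const, smul_eq_mul]
  rw [integral_const_mul, integral_indicator_one (measurableSet_setOf_nsq_le ρ), volume_real_setOf_nsq_le ρ hρ]
  ring

end Volume

/-! ## §3 The orbital bound in the D regime -/

section Orbital

variable {E : Type*} [NormedAddCommGroup E] [NormedSpace ℝ E]

omit [NormedSpace ℝ E] in
/-- Every compactly supported `Θ` has a CORNER SUPPORT RADIUS: `∃ R > 0, R ≤ |X₂₂ − z₂| ⇒ Θ(X) = 0` (★ `exists_radius_apply_add_eq_zero` with `X = z₂•1 + (X − z₂•1)`). [cite: Rudin1980, §1.4] -/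
theorem exists_radius_apply_eq_zero_of_corner (Θ : Matrix (Fin 3) (Fin 3) ℂ → E) (hΘc : HasCompactSupport Θ) (u : ℂ) :
    ∃ R : ℝ, 0 < R ∧ ∀ X : Matrix (Fin 3) (Fin 3) ℂ, R ≤ ‖X 2 2 - u‖ → Θ X = 0 := by
  obtain ⟨R, hR, h⟩ := exists_radius_apply_add_eq_zero Θ hΘc u
  refine ⟨R, hR, fun X hX => ?_⟩
  have hY : R ≤ ‖(X - u • (1 : Matrix (Fin 3) (Fin 3) ℂ)) 2 2‖ := by
    simpa [Matrix.sub_apply, Matrix.smul_apply, Matrix.one_apply_eq] using hX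
  have := h (X - u • (1 : Matrix (Fin 3) (Fin 3) ℂ)) hY
  rwa [add_sub_cancel] at this

omit [NormedSpace ℝ E] in
/-- **SUPPORT OF THE INTEGRAND IN THE D REGIME**: if `Θ(X) = 0` whenever `R ≤ |X₂₂ − z₂|`, then `g ↦ Θ(mat(g·t·g⁻¹))` vanishes off `S_{√2R∕m}` (★ `norm_22_sq_le_of_corner_le`).
[cite: Rogawski1990, §8.4 pp. 126–127] -/
theorem apply_mat_conj_eq_zero_of_not_mem (Θ : Matrix (Fin 3) (Fin 3) ℂ → E) (z : Fin 3 → Circle)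
    (hz : (Matrix.diagonal fun i => (z i : ℂ))ᴴ * J * Matrix.diagonal (fun i => (z i : ℂ)) = J)
    (hD : 0 ≤ ((((z 2 : ℂ) - z 0)) * conj (((z 2 : ℂ) - z 1))).re) {m R : ℝ} (hm : 0 < m)
    (hmle : m ≤ min ‖(z 2 : ℂ) - z 0‖ ‖(z 2 : ℂ) - z 1‖) (hR : ∀ X : Matrix (Fin 3) (Fin 3) ℂ, R ≤ ‖X 2 2 - z 2‖ → Θ X = 0)
    (g : U21) (hg : g ∉ {g : U21 | ‖mat g 2 2‖ ^ 2 ≤ 1 + Real.sqrt 2 * R / m}) :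
    Θ (mat (g * mkU21 (Matrix.diagonal fun i => (z i : ℂ)) hz * g⁻¹)) = 0 := by
  by_contra hne
  apply hg
  refine norm_22_sq_le_of_corner_le g z hz hD hm hmle (le_of_lt (not_le.1 fun h => hne (hR _ h)))

/-- **THE D-REGIME ORBITAL BOUND**: `μ` Haar with volume constant `C` (`μ.real S_ρ ≤ C·ρ²`, §2), `‖Θ‖ ≤ B`, corner support radius `R`, D regime with `0 < m ≤ min(|z₂−z₀|,|z₂−z₁|)`:
`‖∫_G Θ(mat(g·t·g⁻¹)) dμ‖ ≤ B · C · (√2R∕m)²` `= 2BC·R²∕m²`. [cite: Rogawski1990, §8.4 pp. 126–127] [cite: Helgason2000, Ch. I §1 No. 2] -/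
theorem norm_integral_comp_conj_le_of_D (μ : Measure U21) [IsFiniteMeasureOnCompacts μ] {C : ℝ} (hC : ∀ ρ : ℝ, 0 ≤ ρ → μ.real {g : U21 | ‖mat g 2 2‖ ^ 2 ≤ 1 + ρ} ≤ C * ρ ^ 2)
    (Θ : Matrix (Fin 3) (Fin 3) ℂ → E) {B : ℝ} (hB0 : 0 ≤ B) (hB : ∀ X, ‖Θ X‖ ≤ B) (z : Fin 3 → Circle)
    (hz : (Matrix.diagonal fun i => (z i : ℂ))ᴴ * J * Matrix.diagonal (fun i => (z i : ℂ)) = J)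
    (hD : 0 ≤ ((((z 2 : ℂ) - z 0)) * conj (((z 2 : ℂ) - z 1))).re) {m R : ℝ} (hm : 0 < m) (hR0 : 0 ≤ R)
    (hmle : m ≤ min ‖(z 2 : ℂ) - z 0‖ ‖(z 2 : ℂ) - z 1‖) (hR : ∀ X : Matrix (Fin 3) (Fin 3) ℂ, R ≤ ‖X 2 2 - z 2‖ → Θ X = 0) :
    ‖∫ g, Θ (mat (g * mkU21 (Matrix.diagonal fun i => (z i : ℂ)) hz * g⁻¹)) ∂μ‖ ≤ B * (C * (Real.sqrt 2 * R / m) ^ 2) := by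
  set ρ : ℝ := Real.sqrt 2 * R / m with hρ
  have hρ0 : 0 ≤ ρ := by positivity
  set S : Set U21 := {g : U21 | ‖mat g 2 2‖ ^ 2 ≤ 1 + ρ} with hS
  have hzero : ∀ g ∉ S, Θ (mat (g * mkU21 (Matrix.diagonal fun i => (z i : ℂ)) hz * g⁻¹)) = 0 :=
    fun g hg => apply_mat_conj_eq_zero_of_not_mem Θ z hz hD hm hmle hR g hg
  rw [← setIntegral_eq_integral_of_forall_compl_eq_zero hzero]
  have hfin : μ S < ∞ := (isCompact_setOf_norm_22_sq_le hρ0).measure_lt_top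
  calc ‖∫ g in S, Θ (mat (g * mkU21 (Matrix.diagonal fun i => (z i : ℂ)) hz * g⁻¹)) ∂μ‖
      ≤ B * μ.real S := norm_setIntegral_le_of_norm_le_const hfin fun g _ => hB _
    _ ≤ B * (C * ρ ^ 2) := mul_le_mul_of_nonneg_left (hC ρ hρ0) hB0

end Orbital

/-! ## §4 The corner along D-sub-cones: `|Δ|·‖Φ‖ ≤ 4BC R²·M²∕m → 0` -/

section Corner

variable {E : Type*} [NormedAddCommGroup E] [NormedSpace ℝ E]

/-- `|z₀−z₁|·|z₂−z₁|·|z₂−z₀| ≤ 2·min·max²` for the two corner differences `|z₂−z₀|, |z₂−z₁|` (`|z₀−z₁| ≤ |z₂−z₀| + |z₂−z₁| ≤ 2·max`, `min·max = product`).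
[cite: Rogawski1990, §8.4 pp. 126–127] -/
theorem norm_weylProduct_le (a b c : ℂ) :
    ‖a - b‖ * ‖c - b‖ * ‖c - a‖ ≤ 2 * min ‖c - a‖ ‖c - b‖ * (max ‖c - a‖ ‖c - b‖) ^ 2 := by
  have h1 : ‖a - b‖ ≤ ‖c - a‖ + ‖c - b‖ := by
    calc ‖a - b‖ = ‖(c - b) - (c - a)‖ := by congr 1; ring
      _ ≤ ‖c - b‖ + ‖c - a‖ := norm_sub_le _ _
      _ = ‖c - a‖ + ‖c - b‖ := add_comm _ _
  have hM : ‖c - a‖ + ‖c - b‖ ≤ 2 * max ‖c - a‖ ‖c - b‖ := by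
    linarith [le_max_left ‖c - a‖ ‖c - b‖, le_max_right ‖c - a‖ ‖c - b‖]
  have hprod : ‖c - b‖ * ‖c - a‖ = min ‖c - a‖ ‖c - b‖ * max ‖c - a‖ ‖c - b‖ := by
    rw [min_mul_max, mul_comm]
  calc ‖a - b‖ * ‖c - b‖ * ‖c - a‖ = ‖a - b‖ * (‖c - b‖ * ‖c - a‖) := by ring
    _ ≤ (2 * max ‖c - a‖ ‖c - b‖) * (min ‖c - a‖ ‖c - b‖ * max ‖c - a‖ ‖c - b‖) := by
        rw [hprod]
        exact mul_le_mul_of_nonneg_right (h1.trans hM) (mul_nonneg (le_min (norm_nonneg _) (norm_nonneg _)) (le_max_of_le_left (norm_nonneg _)))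
    _ = 2 * min ‖c - a‖ ‖c - b‖ * (max ‖c - a‖ ‖c - b‖) ^ 2 := by ring

/-- **THE D-REGIME CORNER BOUND**: with the data of §3 and `m = min(|z₂−z₀|,|z₂−z₁|) > 0`, `M = max`:
`|z₀−z₁|·|z₂−z₁|·|z₂−z₀| · ‖∫_G Θ(mat(g·t·g⁻¹)) dμ‖ ≤ 4·B·C·R²·M²∕m` — the normalised orbital integral `F_Θ = ρ′Δ·Φ_Θ` (`|ρ′Δ| = |z₀−z₁||z₂−z₁||z₂−z₀|` on the torus) is
`O(M²∕m)` in the D regime. [cite: Rogawski1990, §8.4 pp. 126–127] [cite: HarishChandra1975HARRG1, §17] -/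
theorem weylProduct_mul_norm_integral_comp_conj_le_of_D (μ : Measure U21) [IsFiniteMeasureOnCompacts μ] {C : ℝ}
    (hC : ∀ ρ : ℝ, 0 ≤ ρ → μ.real {g : U21 | ‖mat g 2 2‖ ^ 2 ≤ 1 + ρ} ≤ C * ρ ^ 2)
    (Θ : Matrix (Fin 3) (Fin 3) ℂ → E) {B : ℝ} (hB0 : 0 ≤ B) (hB : ∀ X, ‖Θ X‖ ≤ B) (z : Fin 3 → Circle)
    (hz : (Matrix.diagonal fun i => (z i : ℂ))ᴴ * J * Matrix.diagonal (fun i => (z i : ℂ)) = J)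
    (hD : 0 ≤ ((((z 2 : ℂ) - z 0)) * conj (((z 2 : ℂ) - z 1))).re) (hm : 0 < min ‖(z 2 : ℂ) - z 0‖ ‖(z 2 : ℂ) - z 1‖) {R : ℝ} (hR0 : 0 ≤ R)
    (hR : ∀ X : Matrix (Fin 3) (Fin 3) ℂ, R ≤ ‖X 2 2 - z 2‖ → Θ X = 0) :
    ‖(z 0 : ℂ) - z 1‖ * ‖(z 2 : ℂ) - z 1‖ * ‖(z 2 : ℂ) - z 0‖ * ‖∫ g, Θ (mat (g * mkU21 (Matrix.diagonal fun i => (z i : ℂ)) hz * g⁻¹)) ∂μ‖ ≤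
      4 * B * C * R ^ 2 * (max ‖(z 2 : ℂ) - z 0‖ ‖(z 2 : ℂ) - z 1‖) ^ 2 / min ‖(z 2 : ℂ) - z 0‖ ‖(z 2 : ℂ) - z 1‖ := by
  set m : ℝ := min ‖(z 2 : ℂ) - z 0‖ ‖(z 2 : ℂ) - z 1‖ with hmdef
  set M : ℝ := max ‖(z 2 : ℂ) - z 0‖ ‖(z 2 : ℂ) - z 1‖ with hMdef
  have hI := norm_integral_comp_conj_le_of_D μ hC Θ hB0 hB z hz hD hm hR0 le_rfl hR
  have hW := norm_weylProduct_le (z 0 : ℂ) (z 1 : ℂ) (z 2 : ℂ)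
  have hIn : 0 ≤ ‖∫ g, Θ (mat (g * mkU21 (Matrix.diagonal fun i => (z i : ℂ)) hz * g⁻¹)) ∂μ‖ := norm_nonneg _
  have hWn : 0 ≤ 2 * m * M ^ 2 := by positivity
  calc ‖(z 0 : ℂ) - z 1‖ * ‖(z 2 : ℂ) - z 1‖ * ‖(z 2 : ℂ) - z 0‖ * ‖∫ g, Θ (mat (g * mkU21 (Matrix.diagonal fun i => (z i : ℂ)) hz * g⁻¹)) ∂μ‖
      ≤ (2 * m * M ^ 2) * (B * (C * (Real.sqrt 2 * R / m) ^ 2)) := mul_le_mul hW hI hIn hWn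
    _ = 4 * B * C * R ^ 2 * M ^ 2 / m := by
        have hm0 : m ≠ 0 := hm.ne'
        rw [div_pow, mul_pow, Real.sq_sqrt (by norm_num : (0 : ℝ) ≤ 2)]
        field_simp
        ring

/-- **`F_Θ → 0` ALONG D-SUB-CONES**: if moreover `max ≤ κ·min` (a sub-cone of the D region, `κ ≥ 1`), then `|z₀−z₁||z₂−z₁||z₂−z₀| · ‖Φ_Θ(t)‖ ≤ 4·B·C·R²·κ²·max(|z₂−z₀|,|z₂−z₁|)` — linear in the
distance to the corner, uniformly on the sub-cone. [cite: Rogawski1990, §8.4 pp. 126–127] [cite: HarishChandra1975HARRG1, §17] -/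
theorem weylProduct_mul_norm_integral_comp_conj_le_of_subcone (μ : Measure U21) [IsFiniteMeasureOnCompacts μ] {C : ℝ} (hC0 : 0 ≤ C)
    (hC : ∀ ρ : ℝ, 0 ≤ ρ → μ.real {g : U21 | ‖mat g 2 2‖ ^ 2 ≤ 1 + ρ} ≤ C * ρ ^ 2)
    (Θ : Matrix (Fin 3) (Fin 3) ℂ → E) {B : ℝ} (hB0 : 0 ≤ B) (hB : ∀ X, ‖Θ X‖ ≤ B) (z : Fin 3 → Circle)
    (hz : (Matrix.diagonal fun i => (z i : ℂ))ᴴ * J * Matrix.diagonal (fun i => (z i : ℂ)) = J)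
    (hD : 0 ≤ ((((z 2 : ℂ) - z 0)) * conj (((z 2 : ℂ) - z 1))).re) (hm : 0 < min ‖(z 2 : ℂ) - z 0‖ ‖(z 2 : ℂ) - z 1‖) {R : ℝ} (hR0 : 0 ≤ R)
    (hR : ∀ X : Matrix (Fin 3) (Fin 3) ℂ, R ≤ ‖X 2 2 - z 2‖ → Θ X = 0) {κ : ℝ}
    (hκ : max ‖(z 2 : ℂ) - z 0‖ ‖(z 2 : ℂ) - z 1‖ ≤ κ * min ‖(z 2 : ℂ) - z 0‖ ‖(z 2 : ℂ) - z 1‖) :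
    ‖(z 0 : ℂ) - z 1‖ * ‖(z 2 : ℂ) - z 1‖ * ‖(z 2 : ℂ) - z 0‖ * ‖∫ g, Θ (mat (g * mkU21 (Matrix.diagonal fun i => (z i : ℂ)) hz * g⁻¹)) ∂μ‖ ≤
      4 * B * C * R ^ 2 * κ ^ 2 * max ‖(z 2 : ℂ) - z 0‖ ‖(z 2 : ℂ) - z 1‖ := by
  set m : ℝ := min ‖(z 2 : ℂ) - z 0‖ ‖(z 2 : ℂ) - z 1‖ with hmdef
  set M : ℝ := max ‖(z 2 : ℂ) - z 0‖ ‖(z 2 : ℂ) - z 1‖ with hMdef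
  have h := weylProduct_mul_norm_integral_comp_conj_le_of_D μ hC Θ hB0 hB z hz hD hm hR0 hR
  have hM0 : 0 ≤ M := le_max_of_le_left (norm_nonneg _)
  have hκ0 : 0 ≤ κ := by
    by_contra hneg
    have : M < 0 := lt_of_le_of_lt hκ (mul_neg_of_neg_of_pos (not_le.1 hneg) hm)
    linarith
  -- `M²/m ≤ κ·M ≤ κ²·M`?  We use `M² / m ≤ κ · M` (from `M ≤ κ m`) and `κ ≤ κ²` is NOT assumed; instead `M²/m = M·(M/m) ≤ M·κ ≤ M·κ²` needs `κ ≥ 1`, which follows from `m ≤ M ≤ κ m`.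
  have hκ1 : 1 ≤ κ := by
    have hmM : m ≤ M := min_le_max
    nlinarith [hmM, hκ, hm]
  have hkey : M ^ 2 / m ≤ κ ^ 2 * M := by
    rw [div_le_iff₀ hm]
    have : M * M ≤ (κ * m) * M := mul_le_mul_of_nonneg_right hκ hM0
    nlinarith [this, hκ1, hm, hM0, mul_nonneg (mul_nonneg hκ0 hm.le) hM0]
  calc _ ≤ 4 * B * C * R ^ 2 * M ^ 2 / m := h
    _ = 4 * B * C * R ^ 2 * (M ^ 2 / m) := by ring
    _ ≤ 4 * B * C * R ^ 2 * (κ ^ 2 * M) := mul_le_mul_of_nonneg_left hkey (by positivity)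
    _ = 4 * B * C * R ^ 2 * κ ^ 2 * M := by ring

end Corner

end BallModel

end Literature.Geometry.ComplexHyperbolic

end
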